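import Summits.HodgeConjecture.HodgeConjecture.Cruxes.BlochSeedDiscOne.IntegralityGap
import Summits.HodgeConjecture.HodgeConjecture.Cruxes.BlochSeedDiscOne.HeightTower

/-!
line stmt-HodgeConjecture-18881 Cruxes/BlochSeedDiscOne/Lines/birth.lean 814a6a70c14e831a stub_rung_pad4_seedAt

# B4FloorSymmetry — W∕w1: the symmetry group that PROVABLY acts on the floor problem `FloorFree h B rmin`
(plan-lens-HodgeAV-embed-2 g4, lens «embed ∕ transfer-with-dictionary», RE-POINTED to node W by director-hodge R19.434)

STATUS: evidence about the finite LETTER MODEL of record (`DepthBoundA4.Design`), not rungs. Letters ≠ sheaves. Nothing here is proved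
toward HC ∕ HC_CM ∕ HC_AV ∕ WeilSixfolds ∕ 18881 ∕ 30548 ∕ 26512; no floor `FloorFree h 199 8` is proved here. FEEDS: W (w1) only.
v1.0∕v1.1 imported `IntegralityGap` only (the farm had not built `HeightTower` at typing time, R19.439 ∕ req-114): §0 re-declares verbatim the
`mapD`∕`Tf` bookkeeping of `HeightTower` §0–§3 under THIS namespace, and the floor statement is carried as the bundled `FloorFreeV h B rmin`
(:= `∀ D, Valid h B rmin D → every letter has a > 0`); `floorFreeV_iff_spelled` spells it out LITERALLY as the body of `HeightTower.FloorFree h B rmin`.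
v1.2 (req-114 built): `HeightTower` is now imported too and §8 LINKS the decl of record — `floorFree_iff_floorFreeV : HeightTower.FloorFree h B r ↔ FloorFreeV h B r`
(definitional) — and restates every normal form (P-cells only ∕ octant ∕ `CellNormal`) for `HeightTower.FloorFree` itself (`floorFree_iff_P'`, `floorFree_iff_octant'`,
`floorFree_iff_cellNormal'`), so the nine storeys `FloorFree h 199 8`, `h = 6 … 14`, of `HeightTower.nonex_14_iff_floors` may be attacked in normal form directly.

WHAT IS PROVED (sorry-free). Write `Valid h B rmin D` for the six hypotheses of `FloorFree`∕`Nonex` (`OnAlphabet h`, (A1), (A4), `μ ≠ 0`,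
`copies ≤ B`, `rmin ≤ rank`). Three families of cell maps transport `Valid` (§3–§5):
* factor permutations `permCell σ` (`σ : Equiv.Perm (Fin 4)`): `T_{σD}(w) = T_D(w ∘ σ⁻¹)` (`T_permD`), `μ` fixed (`mu_permD`);
* a quarter-turn `β ↦ iβ` on ONE factor `j` (`rotAt j`): `T_{ρ_j D}(w) = u(w_j)·T_D(w)` with the unit `u(e) = −i, u(ē) = i, u(1) = u(h) = u(pt) = 1`
  (`T_rotD`), so `μ ↦ −i·μ` (`mu_rotD`) — INDEPENDENT rotations on the four factors are symmetries, not only the subgroup `S₀`;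
* GLOBAL complex conjugation `β ↦ β̄` on all four factors (`conjCell`): `T_{κD}(w) = T_D(w with e ↔ ē)` (`T_conjD`), so `μ ↦ T_D(ēēēē) = μ̄`
  (`mu_conjD`, `T_EEEE`).
Hence the group `G = ((ℤ∕4)⁴ ⋊ S₄) ⋊ ℤ∕2`, `|G| = 12 288`, acts on `{D : Valid h B rmin D}` preserving floor letters (`valid_permD`, `valid_rotD`,
`valid_conjD`; `FloorFree`, `Nonex` are `G`-invariant statements). NOT symmetries: a reflection on a proper subset `R` of factors — it sends
`μ = T(eeee)` to `T`(the word with `ē` exactly on `R`), which (A1).1 forces to vanish (`mu_conjAt_eq_zero`: single-factor conjugation kills μ of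
every (A1) design). So the provable group is NOT `D₄ ≀ S₄` (98 304) and is 64× the guess `D₄(global) × S₄` (192).
TWO KERNEL-CHEAP FACTS for the width node W (§6–§7): (F1) floor letters live only in P-cells (`n_letter_pos`: (A4) puts every N-letter amply
above a P-letter with `a ≥ 0`), so `FloorFreeV h B r ↔ ∀ valid D, ∀ c ∈ suppP, ∀ f, 0 < (c f).a` (`floorFree_iff_P`); P-letters are off-axis
(`p_letter_offaxis`, from `no_ample_cover_of_axis`); (F2) WLOG the floor letter sits on factor `0` (`floorFree_iff_factor0`, via `permCell (swap 0 f)`)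
and in the open first quadrant `x > 0, y > 0` (`floorFree_iff_quadrant`, via `rotAt 0`), indeed in the first OCTANT `0 < y ≤ x`, i.e.
`c 0 = (0; h − j, j)`, `1 ≤ j ≤ h∕2` (`floorFree_iff_octant` via the global swap `valid_swapD`; `octant_floor_letter`), and the other three letters
of THAT cell in the open first quadrant (`floorFree_iff_cellNormal`, `CellNormal`; 3·15³ = 10 125 normal-position cells at h = 6).
ORBIT COUNTS (Burnside, exact, HOME `ideators∕plan-lens-HodgeAV-embed-2∕g4∕w1∕orbits2.py` 33e7ee374ea07793): h = 6: P-universe 60⁴ → 1 566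
G-orbits, floor-touching P-cells 10 400 000 → 1 195, all cells 85⁴ → 6 858; floor-touching P-cell orbits for h = 6…14:
1 195 ∕ 3 804 ∕ 10 479 ∕ 25 442 ∕ 56 289 ∕ 114 940 ∕ 220 341 ∕ 399 783 ∕ 693 251. HONEST SCOPE: `G` normalises ONE distinguished cell; it does
not make the support universe certificate-size for whole designs (that is w2∕w3∕w4).
-/

set_option linter.dupNamespace false
set_option autoImplicit false

namespace Summit.HodgeConjecture.HodgeConjecture.Cruxes.BlochSeedDiscOne.B4FloorSymmetry

open Summit.HodgeConjecture.HodgeConjecture.Cruxes.BlochSeedDiscOne.DepthBoundA4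
open Summit.HodgeConjecture.HodgeConjecture.Cruxes.BlochSeedDiscOne.IntegralityGap

/-! ## §0 Bookkeeping ported verbatim from `HeightTower` §0–§3 (plan-lens-HodgeAV-strengthen g9), so that this file imports `IntegralityGap` only -/

/-- `Σ m·u(c)` over a list of (cell, multiplicity) entries. -/
def wsum (L : List (Cell × ℕ)) (u : Cell → GaussianInt) : GaussianInt :=
  (L.map fun cm => (cm.2 : GaussianInt) * u cm.1).sum

theorem wsum_smul (L : List (Cell × ℕ)) (r : GaussianInt) (u : Cell → GaussianInt) :
    wsum L (fun c => r * u c) = r * wsum L u := by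
  induction L with
  | nil => simp [wsum]
  | cons a t ih =>
    simp only [wsum, List.map_cons, List.sum_cons] at ih ⊢
    rw [ih]; ring

/-- `T` as a linear functional of the cell-coefficient function. -/
def Tf (D : Design) (u : Cell → GaussianInt) : GaussianInt := wsum D.N u - wsum D.P u

theorem T_eq_Tf (D : Design) (w : Word) : D.T w = Tf D (fun c => cellCoef c w) := rfl

theorem Tf_smul (D : Design) (r : GaussianInt) (u : Cell → GaussianInt) : Tf D (fun c => r * u c) = r * Tf D u := by
  unfold Tf; rw [wsum_smul, wsum_smul]; ring

theorem Tf_congr (D : Design) {u v : Cell → GaussianInt} (h : ∀ c, u c = v c) : Tf D u = Tf D v := by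
  have : u = v := funext h
  rw [this]

/-- Apply a cell map to both lists of a design (multiplicities unchanged). -/
def mapD (φ : Cell → Cell) (D : Design) : Design :=
  ⟨D.N.map fun cm => (φ cm.1, cm.2), D.P.map fun cm => (φ cm.1, cm.2)⟩

theorem map_snd_mapD (φ : Cell → Cell) (L : List (Cell × ℕ)) :
    (L.map fun cm => (φ cm.1, cm.2)).map Prod.snd = L.map Prod.snd := by
  simp [List.map_map, Function.comp_def]

theorem supp_mapD (φ : Cell → Cell) (L : List (Cell × ℕ)) :
    ((L.map fun cm => (φ cm.1, cm.2)).filter fun cm => 0 < cm.2).map Prod.fst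
      = ((L.filter fun cm => 0 < cm.2).map Prod.fst).map φ := by
  induction L with
  | nil => simp
  | cons a l ih =>
    by_cases ha : 0 < a.2
    · simp [ha, ih]
    · simp [ha, ih]

theorem suppN_mapD (φ : Cell → Cell) (D : Design) : (mapD φ D).suppN = D.suppN.map φ := supp_mapD φ D.N
theorem suppP_mapD (φ : Cell → Cell) (D : Design) : (mapD φ D).suppP = D.suppP.map φ := supp_mapD φ D.P

@[simp] theorem copies_mapD (φ : Cell → Cell) (D : Design) : (mapD φ D).copies = D.copies := by
  simp only [Design.copies, mapD, map_snd_mapD]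

@[simp] theorem rank_mapD (φ : Cell → Cell) (D : Design) : (mapD φ D).rank = D.rank := by
  simp only [Design.rank, mapD, map_snd_mapD]

theorem wsum_mapD (φ : Cell → Cell) (L : List (Cell × ℕ)) (u : Cell → GaussianInt) :
    wsum (L.map fun cm => (φ cm.1, cm.2)) u = wsum L (fun c => u (φ c)) := by
  simp [wsum, List.map_map, Function.comp_def]

theorem T_mapD (φ : Cell → Cell) (D : Design) (w : Word) :
    (mapD φ D).T w = Tf D (fun c => cellCoef (φ c) w) := by
  rw [T_eq_Tf]; simp only [Tf, mapD, wsum_mapD]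

theorem mapD_mapD (φ ψ : Cell → Cell) (D : Design) : mapD φ (mapD ψ D) = mapD (fun c => φ (ψ c)) D := by
  simp [mapD, List.map_map, Function.comp_def]

/-- the product of the coefficients on the factors other than `k`. -/
def restCoef (k : Fin 4) (c : Cell) (w : Word) : GaussianInt :=
  ∏ f ∈ (Finset.univ : Finset (Fin 4)).erase k, (w f).coef (c f)

theorem cellCoef_split (k : Fin 4) (c : Cell) (w : Word) : cellCoef c w = (w k).coef (c k) * restCoef k c w := by
  unfold cellCoef restCoef
  exact (Finset.mul_prod_erase Finset.univ (fun f => (w f).coef (c f)) (Finset.mem_univ k)).symm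

theorem cellCoef_update_split (k : Fin 4) (c : Cell) (w : Word) (s : Sym) :
    cellCoef c (Function.update w k s) = s.coef (c k) * restCoef k c w := by
  unfold cellCoef restCoef
  rw [← Finset.mul_prod_erase Finset.univ (fun f => (Function.update w k s f).coef (c f)) (Finset.mem_univ k),
    Function.update_self]
  congr 1
  refine Finset.prod_congr rfl fun f hf => ?_
  rw [Function.update_of_ne (Finset.ne_of_mem_erase hf)]

theorem update_ne_eeee (w : Word) (k : Fin 4) {s : Sym} (hs : s ≠ Sym.e) : Function.update w k s ≠ Word.eeee := by
  intro h
  have := congrFun h k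
  rw [Function.update_self] at this
  exact hs this

/-! ## §1 The validity bundle -/

/-- The six hypotheses of `FloorFree h B rmin` ∕ `Nonex h B rmin` on a design. -/
structure Valid (h : ℤ) (B : ℕ) (rmin : ℤ) (D : Design) : Prop where
  alpha : D.OnAlphabet h
  a1 : D.A1
  a4 : D.A4
  mu : D.mu ≠ 0
  cop : D.copies ≤ B
  rk : rmin ≤ D.rank

/-- The floor statement over the bundle: FLOOR-FREE(h, B, rmin) = every letter of every valid design has `a > 0`. -/
def FloorFreeV (h : ℤ) (B : ℕ) (rmin : ℤ) : Prop :=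
  ∀ D : Design, Valid h B rmin D → ∀ c ∈ D.suppN ++ D.suppP, ∀ f : Fin 4, 0 < (c f).a

/-- `FloorFreeV` spelled out — LITERALLY the body of `HeightTower.FloorFree h B rmin` (linkage is `Iff.rfl`-deep once `HeightTower` is built). -/
theorem floorFreeV_iff_spelled (h : ℤ) (B : ℕ) (rmin : ℤ) :
    FloorFreeV h B rmin ↔ ∀ D : Design, D.OnAlphabet h → D.A1 → D.A4 → D.mu ≠ 0 → D.copies ≤ B → rmin ≤ D.rank →
      ∀ c ∈ D.suppN ++ D.suppP, ∀ f : Fin 4, 0 < (c f).a :=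
  ⟨fun hF D hA h1 h4 hμ hc hr => hF D ⟨hA, h1, h4, hμ, hc, hr⟩,
   fun hF D hV => hF D hV.alpha hV.a1 hV.a4 hV.mu hV.cop hV.rk⟩

theorem nonex_iff_valid (h : ℤ) (B : ℕ) (rmin : ℤ) : Nonex h B rmin ↔ ∀ D : Design, Valid h B rmin D → False :=
  ⟨fun hF D hV => hF D hV.alpha hV.a1 hV.a4 hV.mu hV.cop hV.rk,
   fun hF D hA h1 h4 hμ hc hr => hF D ⟨hA, h1, h4, hμ, hc, hr⟩⟩

/-- `Nonex` is the stronger statement. -/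
theorem floorFreeV_of_nonex {h : ℤ} {B : ℕ} {rmin : ℤ} (hn : Nonex h B rmin) : FloorFreeV h B rmin :=
  fun D hV => ((nonex_iff_valid h B rmin).mp hn D hV).elim

/-! ## §2 Transport through a cell map `mapD φ` (alphabet, support, (A4)) -/

theorem mem_supp_mapD {φ : Cell → Cell} {D : Design} {c : Cell} :
    c ∈ (mapD φ D).suppN ++ (mapD φ D).suppP ↔ ∃ c₀ ∈ D.suppN ++ D.suppP, φ c₀ = c := by
  rw [suppN_mapD, suppP_mapD, ← List.map_append, List.mem_map]

theorem mem_suppP_mapD {φ : Cell → Cell} {D : Design} {c : Cell} :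
    c ∈ (mapD φ D).suppP ↔ ∃ c₀ ∈ D.suppP, φ c₀ = c := by
  rw [suppP_mapD, List.mem_map]

theorem mem_suppN_mapD {φ : Cell → Cell} {D : Design} {c : Cell} :
    c ∈ (mapD φ D).suppN ↔ ∃ c₀ ∈ D.suppN, φ c₀ = c := by
  rw [suppN_mapD, List.mem_map]

/-- A cell map that sends height-`h` cells to height-`h` cells transports `OnAlphabet h`. -/
theorem onAlphabet_mapD (φ : Cell → Cell) (h : ℤ)
    (hφ : ∀ c : Cell, (∀ f : Fin 4, (c f).OnAlphabet h) → ∀ f : Fin 4, (φ c f).OnAlphabet h)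
    (D : Design) (hA : D.OnAlphabet h) : (mapD φ D).OnAlphabet h := by
  intro c hc f
  obtain ⟨c₀, hc₀, rfl⟩ := mem_supp_mapD.mp hc
  exact hφ c₀ (hA c₀ hc₀) f

/-- A cell map preserving `Live` transports (A4). -/
theorem a4_mapD (φ : Cell → Cell) (hφ : ∀ x y : Cell, Live x y → Live (φ x) (φ y))
    (D : Design) (h4 : D.A4) : (mapD φ D).A4 := by
  obtain ⟨hP, hN⟩ := h4
  refine ⟨?_, ?_⟩
  · intro x hx
    obtain ⟨x₀, hx₀, rfl⟩ := mem_suppP_mapD.mp hx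
    obtain ⟨y₀, hy₀, hl⟩ := hP x₀ hx₀
    exact ⟨φ y₀, mem_suppN_mapD.mpr ⟨y₀, hy₀, rfl⟩, hφ x₀ y₀ hl⟩
  · intro y hy
    obtain ⟨y₀, hy₀, rfl⟩ := mem_suppN_mapD.mp hy
    obtain ⟨x₀, hx₀, hl⟩ := hN y₀ hy₀
    exact ⟨φ x₀, mem_suppP_mapD.mpr ⟨x₀, hx₀, rfl⟩, hφ x₀ y₀ hl⟩

/-! ## §3 Factor permutations -/

/-- Permute the four factors of a cell: `(permCell σ c) f = c (σ f)`. -/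
def permCell (σ : Equiv.Perm (Fin 4)) (c : Cell) : Cell := fun f => c (σ f)

/-- Precompose a word with a permutation. -/
def permWord (τ : Equiv.Perm (Fin 4)) (w : Word) : Word := fun f => w (τ f)

theorem cellCoef_permCell (σ : Equiv.Perm (Fin 4)) (c : Cell) (w : Word) :
    cellCoef (permCell σ c) w = cellCoef c (permWord σ.symm w) := by
  unfold cellCoef permCell permWord
  rw [← Equiv.prod_comp σ (fun g => (w (σ.symm g)).coef (c g))]
  simp only [Equiv.symm_apply_apply]

theorem T_permD (σ : Equiv.Perm (Fin 4)) (D : Design) (w : Word) :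
    (mapD (permCell σ) D).T w = D.T (permWord σ.symm w) := by
  rw [T_mapD, T_eq_Tf]
  exact Tf_congr D fun c => cellCoef_permCell σ c w

theorem efree_permWord (τ : Equiv.Perm (Fin 4)) (w : Word) : (permWord τ w).efree ↔ w.efree :=
  ⟨fun h f => by simpa [permWord] using h (τ.symm f), fun h f => h (τ f)⟩

theorem deg_permWord (τ : Equiv.Perm (Fin 4)) (w : Word) : (permWord τ w).deg = w.deg := by
  unfold Word.deg permWord
  exact Equiv.sum_comp τ (fun f => (w f).deg)

theorem permWord_eq_const_iff (τ : Equiv.Perm (Fin 4)) (w : Word) (s : Sym) :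
    permWord τ w = (fun _ => s) ↔ w = fun _ => s := by
  constructor
  · intro h; funext f
    have := congrFun h (τ.symm f)
    simpa [permWord] using this
  · intro h; funext f; simp [permWord, h]

theorem a1_permD (σ : Equiv.Perm (Fin 4)) (D : Design) (h1 : D.A1) : (mapD (permCell σ) D).A1 := by
  obtain ⟨hM, hE⟩ := h1
  refine ⟨?_, ?_⟩
  · intro w hw he hE'
    rw [T_permD]
    refine hM _ (fun h => hw ((efree_permWord _ _).mp h)) ?_ ?_
    · exact fun h => he ((permWord_eq_const_iff σ.symm w Sym.e).mp h)
    · exact fun h => hE' ((permWord_eq_const_iff σ.symm w Sym.ebar).mp h)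
  · intro w w' hw hw' hd
    rw [T_permD, T_permD]
    exact hE _ _ ((efree_permWord _ _).mpr hw) ((efree_permWord _ _).mpr hw')
      (by rw [deg_permWord, deg_permWord, hd])

theorem mu_permD (σ : Equiv.Perm (Fin 4)) (D : Design) : (mapD (permCell σ) D).mu = D.mu := by
  unfold Design.mu
  rw [T_permD]
  rfl

theorem live_permCell (σ : Equiv.Perm (Fin 4)) (x y : Cell) : Live (permCell σ x) (permCell σ y) ↔ Live x y :=
  ⟨fun h f => by simpa [permCell] using h (σ.symm f), fun h f => h (σ f)⟩

theorem valid_permD (σ : Equiv.Perm (Fin 4)) {h : ℤ} {B : ℕ} {rmin : ℤ} {D : Design} (hV : Valid h B rmin D) :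
    Valid h B rmin (mapD (permCell σ) D) where
  alpha := onAlphabet_mapD _ h (fun c hc f => hc (σ f)) D hV.alpha
  a1 := a1_permD σ D hV.a1
  a4 := a4_mapD _ (fun x y hl => (live_permCell σ x y).mpr hl) D hV.a4
  mu := by rw [mu_permD]; exact hV.mu
  cop := by rw [copies_mapD]; exact hV.cop
  rk := by rw [rank_mapD]; exact hV.rk

/-! ## §4 A quarter-turn on one factor -/

/-- Rotate the letter on factor `j` by a quarter turn `β ↦ iβ`. -/
def rotAt (j : Fin 4) (c : Cell) : Cell := Function.update c j (c j).rotI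

@[simp] theorem rotAt_self (j : Fin 4) (c : Cell) : rotAt j c j = (c j).rotI := by simp [rotAt]
theorem rotAt_of_ne {j f : Fin 4} (h : f ≠ j) (c : Cell) : rotAt j c f = c f := by simp [rotAt, Function.update_of_ne h]

/-- The unit by which a quarter turn multiplies the coefficient of a symbol. -/
def rotUnit : Sym → GaussianInt
  | Sym.e => ⟨0, -1⟩
  | Sym.ebar => ⟨0, 1⟩
  | _ => 1

theorem rotUnit_ne_zero (s : Sym) : rotUnit s ≠ 0 := by cases s <;> decide

theorem rotUnit_of_efree {s : Sym} (hs : s.efree = true) : rotUnit s = 1 := by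
  cases s <;> simp_all [rotUnit, Sym.efree]

theorem coef_rotI (s : Sym) (ℓ : Letter) : s.coef ℓ.rotI = rotUnit s * s.coef ℓ := by
  cases s with
  | one => simp [Sym.coef, rotUnit]
  | h => simp [Sym.coef, rotUnit, Letter.rotI]
  | e => simp only [Sym.coef, rotUnit, Letter.rotI, Letter.beta]; ext <;> simp
  | ebar => simp only [Sym.coef, rotUnit, Letter.rotI, Letter.beta]; ext <;> simp
  | pt =>
    simp only [Sym.coef, rotUnit, Letter.rotI, Letter.selfInt, Letter.bnorm, one_mul]
    congr 1; ring

theorem restCoef_rotAt (j : Fin 4) (c : Cell) (w : Word) : restCoef j (rotAt j c) w = restCoef j c w := by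
  unfold restCoef
  refine Finset.prod_congr rfl fun f hf => ?_
  rw [rotAt_of_ne (Finset.ne_of_mem_erase hf)]

theorem cellCoef_rotAt (j : Fin 4) (c : Cell) (w : Word) : cellCoef (rotAt j c) w = rotUnit (w j) * cellCoef c w := by
  rw [cellCoef_split j (rotAt j c) w, cellCoef_split j c w, restCoef_rotAt, rotAt_self, coef_rotI]
  ring

theorem T_rotD (j : Fin 4) (D : Design) (w : Word) : (mapD (rotAt j) D).T w = rotUnit (w j) * D.T w := by
  rw [T_mapD, T_eq_Tf, ← Tf_smul]
  exact Tf_congr D fun c => cellCoef_rotAt j c w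

theorem a1_rotD (j : Fin 4) (D : Design) (h1 : D.A1) : (mapD (rotAt j) D).A1 := by
  obtain ⟨hM, hE⟩ := h1
  refine ⟨?_, ?_⟩
  · intro w hw he hE'
    rw [T_rotD, hM w hw he hE', mul_zero]
  · intro w w' hw hw' hd
    rw [T_rotD, T_rotD, rotUnit_of_efree (hw j), rotUnit_of_efree (hw' j), hE w w' hw hw' hd]

theorem mu_rotD (j : Fin 4) (D : Design) : (mapD (rotAt j) D).mu = ⟨0, -1⟩ * D.mu := by
  unfold Design.mu
  rw [T_rotD]
  rfl

theorem ampleAbove_rotI (ℓ ℓ' : Letter) : AmpleAbove ℓ.rotI ℓ'.rotI ↔ AmpleAbove ℓ ℓ' := by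
  simp only [AmpleAbove, Letter.rotI]
  constructor <;> rintro ⟨h1, h2⟩ <;> exact ⟨h1, by nlinarith [h2]⟩

theorem live_rotAt (j : Fin 4) (x y : Cell) : Live (rotAt j x) (rotAt j y) ↔ Live x y := by
  constructor
  · intro h f
    by_cases hf : f = j
    · subst hf; have := h f; rwa [rotAt_self, rotAt_self, ampleAbove_rotI] at this
    · have := h f; rwa [rotAt_of_ne hf, rotAt_of_ne hf] at this
  · intro h f
    by_cases hf : f = j
    · subst hf; rw [rotAt_self, rotAt_self, ampleAbove_rotI]; exact h f
    · rw [rotAt_of_ne hf, rotAt_of_ne hf]; exact h f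

theorem onAlphabet_rotI (h : ℤ) (ℓ : Letter) : ℓ.rotI.OnAlphabet h ↔ ℓ.OnAlphabet h := by
  simp only [Letter.OnAlphabet, Letter.height, Letter.rotI, abs_neg]
  constructor <;> rintro ⟨h1, h2⟩ <;> exact ⟨by linarith, h2⟩

theorem valid_rotD (j : Fin 4) {h : ℤ} {B : ℕ} {rmin : ℤ} {D : Design} (hV : Valid h B rmin D) :
    Valid h B rmin (mapD (rotAt j) D) where
  alpha := onAlphabet_mapD _ h (fun c hc f => by
      by_cases hf : f = j
      · subst hf; rw [rotAt_self, onAlphabet_rotI]; exact hc f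
      · rw [rotAt_of_ne hf]; exact hc f) D hV.alpha
  a1 := a1_rotD j D hV.a1
  a4 := a4_mapD _ (fun x y hl => (live_rotAt j x y).mpr hl) D hV.a4
  mu := by rw [mu_rotD]; exact mul_ne_zero (by decide) hV.mu
  cop := by rw [copies_mapD]; exact hV.cop
  rk := by rw [rank_mapD]; exact hV.rk

/-! ## §5 Global complex conjugation (and why a PARTIAL conjugation is not a symmetry) -/

/-- `β ↦ β̄` on one letter. -/
def conjL (ℓ : Letter) : Letter := ⟨ℓ.a, ℓ.x, -ℓ.y⟩

/-- `β ↦ β̄` on every factor of a cell. -/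
def conjCell (c : Cell) : Cell := fun f => conjL (c f)

/-- `β ↦ β̄` on factor `j` only (NOT a symmetry: `mu_conjAt_eq_zero`). -/
def conjAt (j : Fin 4) (c : Cell) : Cell := Function.update c j (conjL (c j))

/-- Swap the symbols `e ↔ ē`. -/
def swapE : Sym → Sym
  | Sym.e => Sym.ebar
  | Sym.ebar => Sym.e
  | s => s

theorem swapE_efree (s : Sym) : (swapE s).efree = s.efree := by cases s <;> rfl
theorem swapE_deg (s : Sym) : (swapE s).deg = s.deg := by cases s <;> rfl
theorem swapE_swapE (s : Sym) : swapE (swapE s) = s := by cases s <;> rfl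

theorem coef_conjL (s : Sym) (ℓ : Letter) : s.coef (conjL ℓ) = (swapE s).coef ℓ := by
  cases s with
  | one => rfl
  | h => rfl
  | e => simp only [Sym.coef, swapE, conjL, Letter.beta]; ext <;> simp
  | ebar => simp only [Sym.coef, swapE, conjL, Letter.beta]; ext <;> simp
  | pt => simp only [Sym.coef, swapE, conjL, Letter.selfInt, Letter.bnorm]; congr 1; ring

/-- The word with `e ↔ ē` swapped on every factor. -/
def swapW (w : Word) : Word := fun f => swapE (w f)

theorem swapW_swapW (w : Word) : swapW (swapW w) = w := by funext f; exact swapE_swapE (w f)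
theorem efree_swapW (w : Word) : (swapW w).efree ↔ w.efree := by
  simp only [Word.efree, swapW, swapE_efree]
theorem deg_swapW (w : Word) : (swapW w).deg = w.deg := by
  simp only [Word.deg, swapW, swapE_deg]
theorem swapW_eeee : swapW Word.eeee = Word.EEEE := by funext f; rfl
theorem swapW_EEEE : swapW Word.EEEE = Word.eeee := by funext f; rfl
theorem swapW_eq_eeee {w : Word} (h : swapW w = Word.eeee) : w = Word.EEEE := by
  rw [← swapW_swapW w, h, swapW_eeee]
theorem swapW_eq_EEEE {w : Word} (h : swapW w = Word.EEEE) : w = Word.eeee := by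
  rw [← swapW_swapW w, h, swapW_EEEE]

theorem cellCoef_conjCell (c : Cell) (w : Word) : cellCoef (conjCell c) w = cellCoef c (swapW w) := by
  unfold cellCoef conjCell swapW
  exact Finset.prod_congr rfl fun f _ => coef_conjL (w f) (c f)

theorem T_conjD (D : Design) (w : Word) : (mapD conjCell D).T w = D.T (swapW w) := by
  rw [T_mapD, T_eq_Tf]
  exact Tf_congr D fun c => cellCoef_conjCell c w

theorem a1_conjD (D : Design) (h1 : D.A1) : (mapD conjCell D).A1 := by
  obtain ⟨hM, hE⟩ := h1
  refine ⟨?_, ?_⟩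
  · intro w hw he hE'
    rw [T_conjD]
    exact hM _ (fun h => hw ((efree_swapW w).mp h)) (fun h => hE' (swapW_eq_eeee h)) (fun h => he (swapW_eq_EEEE h))
  · intro w w' hw hw' hd
    rw [T_conjD, T_conjD]
    exact hE _ _ ((efree_swapW w).mpr hw) ((efree_swapW w').mpr hw') (by rw [deg_swapW, deg_swapW, hd])

/-- `Σ m·star(u c) = star (Σ m·u c)`. -/
theorem wsum_star (L : List (Cell × ℕ)) (u : Cell → GaussianInt) :
    wsum L (fun c => star (u c)) = star (wsum L u) := by
  induction L with
  | nil => simp [wsum]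
  | cons a t ih =>
    simp only [wsum, List.map_cons, List.sum_cons] at ih ⊢
    rw [ih, star_add, star_mul', star_natCast]

theorem Tf_star (D : Design) (u : Cell → GaussianInt) : Tf D (fun c => star (u c)) = star (Tf D u) := by
  unfold Tf; rw [wsum_star, wsum_star, star_sub]

theorem cellCoef_EEEE (c : Cell) : cellCoef c Word.EEEE = star (cellCoef c Word.eeee) := by
  unfold cellCoef
  rw [star_prod]
  refine Finset.prod_congr rfl fun f _ => ?_
  simp [Word.eeee, Word.EEEE, Sym.coef]

/-- `T(ēēēē) = conj T(eeee)` for every design. -/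
theorem T_EEEE (D : Design) : D.T Word.EEEE = star (D.T Word.eeee) := by
  rw [T_eq_Tf, T_eq_Tf, ← Tf_star]
  exact Tf_congr D fun c => cellCoef_EEEE c

theorem mu_conjD (D : Design) : (mapD conjCell D).mu = star D.mu := by
  unfold Design.mu
  rw [T_conjD, swapW_eeee, T_EEEE]

theorem ampleAbove_conjL (ℓ ℓ' : Letter) : AmpleAbove (conjL ℓ) (conjL ℓ') ↔ AmpleAbove ℓ ℓ' := by
  simp only [AmpleAbove, conjL]
  constructor <;> rintro ⟨h1, h2⟩ <;> exact ⟨h1, by nlinarith [h2]⟩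

theorem live_conjCell (x y : Cell) : Live (conjCell x) (conjCell y) ↔ Live x y := by
  simp only [Live, conjCell, ampleAbove_conjL]

theorem onAlphabet_conjL (h : ℤ) (ℓ : Letter) : (conjL ℓ).OnAlphabet h ↔ ℓ.OnAlphabet h := by
  simp only [Letter.OnAlphabet, Letter.height, conjL, abs_neg]

theorem valid_conjD {h : ℤ} {B : ℕ} {rmin : ℤ} {D : Design} (hV : Valid h B rmin D) :
    Valid h B rmin (mapD conjCell D) where
  alpha := onAlphabet_mapD _ h (fun c hc f => by rw [conjCell, onAlphabet_conjL]; exact hc f) D hV.alpha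
  a1 := a1_conjD D hV.a1
  a4 := a4_mapD _ (fun x y hl => (live_conjCell x y).mpr hl) D hV.a4
  mu := by rw [mu_conjD]; exact fun h0 => hV.mu (star_eq_zero.mp h0)
  cop := by rw [copies_mapD]; exact hV.cop
  rk := by rw [rank_mapD]; exact hV.rk

/-! ### Partial conjugation kills `μ` -/

theorem restCoef_conjAt (j : Fin 4) (c : Cell) (w : Word) : restCoef j (conjAt j c) w = restCoef j c w := by
  unfold restCoef
  refine Finset.prod_congr rfl fun f hf => ?_
  rw [conjAt, Function.update_of_ne (Finset.ne_of_mem_erase hf)]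

theorem cellCoef_conjAt (j : Fin 4) (c : Cell) (w : Word) :
    cellCoef (conjAt j c) w = cellCoef c (Function.update w j (swapE (w j))) := by
  rw [cellCoef_split j (conjAt j c) w, cellCoef_update_split, restCoef_conjAt]
  simp only [conjAt, Function.update_self, coef_conjL]

theorem T_conjAtD (j : Fin 4) (D : Design) (w : Word) :
    (mapD (conjAt j) D).T w = D.T (Function.update w j (swapE (w j))) := by
  rw [T_mapD, T_eq_Tf]
  exact Tf_congr D fun c => cellCoef_conjAt j c w

/-- Conjugating ONE factor of an (A1)-clean design gives a design with `μ = 0`: the new Bloch coefficient is the old coefficient of the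
e-mixed word `e…ē_j…e`, which (A1).1 kills. So single-factor reflections are NOT symmetries of the floor problem. -/
theorem mu_conjAt_eq_zero (j : Fin 4) (D : Design) (h1 : D.A1) : (mapD (conjAt j) D).mu = 0 := by
  unfold Design.mu
  rw [T_conjAtD]
  have hj : Word.eeee j = Sym.e := rfl
  rw [hj]
  refine h1.1 _ ?_ ?_ ?_
  · intro h
    have := h j
    rw [Function.update_self] at this
    exact Bool.false_ne_true this
  · exact update_ne_eeee _ j (by decide)
  · intro h
    have h0 : Function.update Word.eeee j (swapE Sym.e) (j + 1) = Word.EEEE (j + 1) := by rw [h]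
    rw [Function.update_of_ne (by omega)] at h0
    exact absurd h0 (by simp [Word.eeee, Word.EEEE])

/-! ## §6 (F1): floor letters live only in P-cells; P-letters are off-axis -/

theorem suppP_sub {D : Design} {c : Cell} (hc : c ∈ D.suppP) : c ∈ D.suppN ++ D.suppP :=
  List.mem_append_right _ hc
theorem suppN_sub {D : Design} {c : Cell} (hc : c ∈ D.suppN) : c ∈ D.suppN ++ D.suppP :=
  List.mem_append_left _ hc

/-- (F1) every N-letter of a valid design has `a ≥ 1` (it is amply above a P-letter with `a ≥ 0`). -/
theorem n_letter_pos {h : ℤ} {B : ℕ} {rmin : ℤ} {D : Design} (hV : Valid h B rmin D) :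
    ∀ y ∈ D.suppN, ∀ f : Fin 4, 0 < (y f).a := by
  intro y hy f
  obtain ⟨x, hx, hl⟩ := hV.a4.2 y hy
  have h0 : 0 ≤ (x f).a := (hV.alpha x (suppP_sub hx) f).2
  have h1 : (x f).a < (y f).a := (hl f).1
  omega

/-- P-letters of a valid design are off-axis (`x·y ≠ 0`). -/
theorem p_letter_offaxis {h : ℤ} {B : ℕ} {rmin : ℤ} {D : Design} (hV : Valid h B rmin D) :
    ∀ x ∈ D.suppP, ∀ f : Fin 4, ¬ (x f).isAxis := by
  intro x hx f hax
  obtain ⟨y, hy, hl⟩ := hV.a4.1 x hx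
  have hh : (x f).height = (y f).height := by
    rw [(hV.alpha x (suppP_sub hx) f).1, (hV.alpha y (suppN_sub hy) f).1]
  exact no_ample_cover_of_axis (x f) (y f) hh hax (hl f)

/-- `FloorFree` needs checking on P-cells only. -/
theorem floorFree_iff_P (h : ℤ) (B : ℕ) (rmin : ℤ) :
    FloorFreeV h B rmin ↔ ∀ D : Design, Valid h B rmin D → ∀ c ∈ D.suppP, ∀ f : Fin 4, 0 < (c f).a := by
  refine ⟨fun hF D hV c hc f => hF D hV c (suppP_sub hc) f, fun hF D hV c hc f => ?_⟩
  rcases List.mem_append.mp hc with hN | hP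
  · exact n_letter_pos hV c hN f
  · exact hF D hV c hP f

/-! ## §7 (F2): normal position of the floor letter -/

/-- WLOG the floor letter sits on factor `0`. -/
theorem floorFree_iff_factor0 (h : ℤ) (B : ℕ) (rmin : ℤ) :
    FloorFreeV h B rmin ↔ ∀ D : Design, Valid h B rmin D → ∀ c ∈ D.suppP, 0 < (c 0).a := by
  rw [floorFree_iff_P]
  refine ⟨fun hF D hV c hc => hF D hV c hc 0, fun hF D hV c hc f => ?_⟩
  have hV' := valid_permD (Equiv.swap 0 f) hV
  have hc' : permCell (Equiv.swap 0 f) c ∈ (mapD (permCell (Equiv.swap 0 f)) D).suppP :=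
    mem_suppP_mapD.mpr ⟨c, hc, rfl⟩
  have := hF _ hV' _ hc'
  simpa [permCell, Equiv.swap_apply_left] using this

/-- Iterated quarter turn on factor `0`. -/
def rotAtPow (k : ℕ) (D : Design) : Design := (mapD (rotAt 0))^[k] D

theorem valid_rotAtPow (k : ℕ) {h : ℤ} {B : ℕ} {rmin : ℤ} {D : Design} (hV : Valid h B rmin D) :
    Valid h B rmin (rotAtPow k D) := by
  induction k with
  | zero => exact hV
  | succ k ih => rw [rotAtPow, Function.iterate_succ_apply']; exact valid_rotD 0 ih

theorem rotAtPow_eq_mapD (k : ℕ) (D : Design) : rotAtPow k D = mapD (fun c => (rotAt 0)^[k] c) D := by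
  induction k with
  | zero => simp [rotAtPow, mapD]
  | succ k ih =>
    rw [rotAtPow, Function.iterate_succ_apply', ← rotAtPow, ih, mapD_mapD]
    congr 1
    funext c
    rw [Function.iterate_succ_apply']

theorem rotAt_iter_zero (k : ℕ) (c : Cell) : ((rotAt 0)^[k] c) 0 = Letter.rotI^[k] (c 0) := by
  induction k with
  | zero => rfl
  | succ k ih => rw [Function.iterate_succ_apply', Function.iterate_succ_apply', rotAt_self, ih]

theorem rotI_a (ℓ : Letter) : ℓ.rotI.a = ℓ.a := rfl
theorem rotI_iter_a (k : ℕ) (ℓ : Letter) : (Letter.rotI^[k] ℓ).a = ℓ.a := by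
  induction k with
  | zero => rfl
  | succ k ih => rw [Function.iterate_succ_apply', rotI_a, ih]

/-- An off-axis letter rotates into the open first quadrant. -/
theorem exists_rot_quadrant (ℓ : Letter) (hℓ : ¬ ℓ.isAxis) :
    ∃ k : ℕ, k < 4 ∧ 0 < (Letter.rotI^[k] ℓ).x ∧ 0 < (Letter.rotI^[k] ℓ).y := by
  have hx : ℓ.x ≠ 0 := fun h0 => hℓ (by simp [Letter.isAxis, h0])
  have hy : ℓ.y ≠ 0 := fun h0 => hℓ (by simp [Letter.isAxis, h0])
  have e1 : Letter.rotI^[1] ℓ = ⟨ℓ.a, -ℓ.y, ℓ.x⟩ := rfl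
  have e2 : Letter.rotI^[2] ℓ = ⟨ℓ.a, -ℓ.x, -ℓ.y⟩ := by
    show Letter.rotI (Letter.rotI ℓ) = _; simp [Letter.rotI]
  have e3 : Letter.rotI^[3] ℓ = ⟨ℓ.a, ℓ.y, -ℓ.x⟩ := by
    show Letter.rotI (Letter.rotI (Letter.rotI ℓ)) = _; simp [Letter.rotI]
  rcases lt_or_gt_of_ne hx with hx | hx <;> rcases lt_or_gt_of_ne hy with hy | hy
  · exact ⟨2, by omega, by rw [e2]; simp; omega, by rw [e2]; simp; omega⟩
  · exact ⟨3, by omega, by rw [e3]; simpa using hy, by rw [e3]; simp; omega⟩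
  · exact ⟨1, by omega, by rw [e1]; simp; omega, by rw [e1]; simpa using hx⟩
  · exact ⟨0, by omega, hx, hy⟩

/-- (F2) WLOG the floor letter sits on factor `0` in the open first quadrant: `c 0 = (0; x, y)` with `x, y > 0` (`x + y = h`). -/
theorem floorFree_iff_quadrant (h : ℤ) (B : ℕ) (rmin : ℤ) :
    FloorFreeV h B rmin ↔ ∀ D : Design, Valid h B rmin D → ∀ c ∈ D.suppP,
      ¬ ((c 0).a = 0 ∧ 0 < (c 0).x ∧ 0 < (c 0).y) := by
  rw [floorFree_iff_factor0]
  refine ⟨fun hF D hV c hc hq => by have := hF D hV c hc; omega, fun hF D hV c hc => ?_⟩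
  by_contra hle
  have h0 : (c 0).a = 0 := by have := (hV.alpha c (suppP_sub hc) 0).2; omega
  obtain ⟨k, -, hkx, hky⟩ := exists_rot_quadrant (c 0) (p_letter_offaxis hV c hc 0)
  have hV' := valid_rotAtPow k hV
  have hc' : (rotAt 0)^[k] c ∈ (rotAtPow k D).suppP := by
    rw [rotAtPow_eq_mapD]; exact mem_suppP_mapD.mpr ⟨c, hc, rfl⟩
  refine hF _ hV' _ hc' ⟨?_, ?_, ?_⟩
  · rw [rotAt_iter_zero, rotI_iter_a, h0]
  · rw [rotAt_iter_zero]; exact hkx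
  · rw [rotAt_iter_zero]; exact hky

/-! ### The global swap `x ↔ y` (= conjugation followed by a quarter turn on every factor) and the first OCTANT -/

/-- `(x, y) ↦ (y, x)` on one letter. -/
def swapL (ℓ : Letter) : Letter := ⟨ℓ.a, ℓ.y, ℓ.x⟩

/-- `(x, y) ↦ (y, x)` on every factor of a cell. -/
def swapCell (c : Cell) : Cell := fun f => swapL (c f)

theorem swapL_eq (ℓ : Letter) : swapL ℓ = (conjL ℓ).rotI := by
  simp [swapL, conjL, Letter.rotI]

theorem swapCell_eq (c : Cell) : swapCell c = rotAt 0 (rotAt 1 (rotAt 2 (rotAt 3 (conjCell c)))) := by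
  funext f
  simp only [swapCell, swapL_eq]
  fin_cases f <;> simp [rotAt, conjCell, Function.update]

theorem swapD_eq (D : Design) :
    mapD swapCell D = mapD (rotAt 0) (mapD (rotAt 1) (mapD (rotAt 2) (mapD (rotAt 3) (mapD conjCell D)))) := by
  simp only [mapD_mapD]
  congr 1
  funext c
  exact swapCell_eq c

theorem valid_swapD {h : ℤ} {B : ℕ} {rmin : ℤ} {D : Design} (hV : Valid h B rmin D) : Valid h B rmin (mapD swapCell D) := by
  rw [swapD_eq]
  exact valid_rotD 0 (valid_rotD 1 (valid_rotD 2 (valid_rotD 3 (valid_conjD hV))))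

/-- (F2, full) WLOG the floor letter is `c 0 = (0; x, y)` with `0 < y ≤ x` (so `c 0 = (0; h − j, j)`, `1 ≤ j ≤ h ∕ 2`). -/
theorem floorFree_iff_octant (h : ℤ) (B : ℕ) (rmin : ℤ) :
    FloorFreeV h B rmin ↔ ∀ D : Design, Valid h B rmin D → ∀ c ∈ D.suppP,
      ¬ ((c 0).a = 0 ∧ 0 < (c 0).y ∧ (c 0).y ≤ (c 0).x) := by
  rw [floorFree_iff_quadrant]
  refine ⟨fun hF D hV c hc hq => hF D hV c hc ⟨hq.1, by omega, hq.2.1⟩, fun hF D hV c hc hq => ?_⟩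
  obtain ⟨h0, hx, hy⟩ := hq
  rcases le_or_gt (c 0).y (c 0).x with hle | hlt
  · exact hF D hV c hc ⟨h0, hy, hle⟩
  · have hV' := valid_swapD hV
    have hc' : swapCell c ∈ (mapD swapCell D).suppP := mem_suppP_mapD.mpr ⟨c, hc, rfl⟩
    exact hF _ hV' _ hc' ⟨by simpa [swapCell, swapL] using h0, by simpa [swapCell, swapL] using hx,
      by simp only [swapCell, swapL]; omega⟩

/-- On the height-`h` alphabet the octant floor letter is `(0; h − j, j)` with `1 ≤ j` and `2j ≤ h`. -/
theorem octant_floor_letter {h : ℤ} {ℓ : Letter} (hA : ℓ.OnAlphabet h) (h0 : ℓ.a = 0) (hy : 0 < ℓ.y) (hyx : ℓ.y ≤ ℓ.x) :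
    ℓ.x = h - ℓ.y ∧ 1 ≤ ℓ.y ∧ 2 * ℓ.y ≤ h := by
  obtain ⟨hh, -⟩ := hA
  simp only [Letter.height, h0] at hh
  rw [abs_of_pos (lt_of_lt_of_le hy hyx), abs_of_pos hy] at hh
  omega

/-! ### Normal form of the whole distinguished cell: every letter in the open first quadrant -/

/-- Iterated quarter turn on factor `j`. -/
def rotPowAt (j : Fin 4) (k : ℕ) (D : Design) : Design := (mapD (rotAt j))^[k] D

theorem valid_rotPowAt (j : Fin 4) (k : ℕ) {h : ℤ} {B : ℕ} {rmin : ℤ} {D : Design} (hV : Valid h B rmin D) :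
    Valid h B rmin (rotPowAt j k D) := by
  induction k with
  | zero => exact hV
  | succ k ih => rw [rotPowAt, Function.iterate_succ_apply']; exact valid_rotD j ih

theorem rotPowAt_eq_mapD (j : Fin 4) (k : ℕ) (D : Design) : rotPowAt j k D = mapD (fun c => (rotAt j)^[k] c) D := by
  induction k with
  | zero => simp [rotPowAt, mapD]
  | succ k ih =>
    rw [rotPowAt, Function.iterate_succ_apply', ← rotPowAt, ih, mapD_mapD]
    congr 1
    funext c
    rw [Function.iterate_succ_apply']

theorem rotAt_iter_self (j : Fin 4) (k : ℕ) (c : Cell) : ((rotAt j)^[k] c) j = Letter.rotI^[k] (c j) := by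
  induction k with
  | zero => rfl
  | succ k ih => rw [Function.iterate_succ_apply', Function.iterate_succ_apply', rotAt_self, ih]

theorem rotAt_iter_of_ne {j f : Fin 4} (hf : f ≠ j) (k : ℕ) (c : Cell) : ((rotAt j)^[k] c) f = c f := by
  induction k with
  | zero => rfl
  | succ k ih => rw [Function.iterate_succ_apply', rotAt_of_ne hf, ih]

/-- One normalisation step: rotate factor `j ≠ 0` of a chosen P-cell into the open first quadrant, keeping every other factor of that cell. -/
theorem normalise_factor {h : ℤ} {B : ℕ} {rmin : ℤ} {D : Design} (hV : Valid h B rmin D) {c : Cell} (hc : c ∈ D.suppP)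
    (j : Fin 4) :
    ∃ D' : Design, ∃ c' : Cell, Valid h B rmin D' ∧ c' ∈ D'.suppP ∧ (∀ f : Fin 4, f ≠ j → c' f = c f) ∧
      0 < (c' j).x ∧ 0 < (c' j).y := by
  obtain ⟨k, -, hkx, hky⟩ := exists_rot_quadrant (c j) (p_letter_offaxis hV c hc j)
  refine ⟨rotPowAt j k D, (rotAt j)^[k] c, valid_rotPowAt j k hV, ?_, ?_, ?_, ?_⟩
  · rw [rotPowAt_eq_mapD]; exact mem_suppP_mapD.mpr ⟨c, hc, rfl⟩
  · intro f hf; exact rotAt_iter_of_ne hf k c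
  · rw [rotAt_iter_self]; exact hkx
  · rw [rotAt_iter_self]; exact hky

/-- The explicit representative list for ONE distinguished cell: floor letter on factor `0` in the first octant, the other three letters in
the open first quadrant. -/
def CellNormal (c : Cell) : Prop :=
  (c 0).a = 0 ∧ 0 < (c 0).y ∧ (c 0).y ≤ (c 0).x ∧ ∀ f : Fin 4, f ≠ 0 → 0 < (c f).x ∧ 0 < (c f).y

/-- (F2, cell form) `FloorFreeV h B r` ⟺ no valid design has a P-cell in normal position (`CellNormal`). At `h = 6` the normal-position cells
number `3 · 15³ = 10 125` (floor letter `(0;5,1), (0;4,2), (0;3,3)`; 15 first-quadrant letters per other factor). -/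
theorem floorFree_iff_cellNormal (h : ℤ) (B : ℕ) (rmin : ℤ) :
    FloorFreeV h B rmin ↔ ∀ D : Design, Valid h B rmin D → ∀ c ∈ D.suppP, ¬ CellNormal c := by
  rw [floorFree_iff_octant]
  refine ⟨fun hF D hV c hc hq => hF D hV c hc ⟨hq.1, hq.2.1, hq.2.2.1⟩, fun hF D hV c hc hq => ?_⟩
  obtain ⟨h0, hy, hyx⟩ := hq
  -- normalise factors 1, 2, 3 in turn
  obtain ⟨D₁, c₁, hV₁, hc₁, he₁, hx₁, hy₁⟩ := normalise_factor hV hc 1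
  obtain ⟨D₂, c₂, hV₂, hc₂, he₂, hx₂, hy₂⟩ := normalise_factor hV₁ hc₁ 2
  obtain ⟨D₃, c₃, hV₃, hc₃, he₃, hx₃, hy₃⟩ := normalise_factor hV₂ hc₂ 3
  have e30 : c₃ 0 = c 0 := by rw [he₃ 0 (by decide), he₂ 0 (by decide), he₁ 0 (by decide)]
  have e31 : c₃ 1 = c₁ 1 := by rw [he₃ 1 (by decide), he₂ 1 (by decide)]
  have e32 : c₃ 2 = c₂ 2 := by rw [he₃ 2 (by decide)]
  refine hF D₃ hV₃ c₃ hc₃ ⟨by rw [e30]; exact h0, by rw [e30]; exact hy, by rw [e30]; exact hyx, ?_⟩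
  intro f hf
  fin_cases f
  · exact absurd rfl hf
  · exact ⟨by simpa [e31] using hx₁, by simpa [e31] using hy₁⟩
  · exact ⟨by simpa [e32] using hx₂, by simpa [e32] using hy₂⟩
  · exact ⟨hx₃, hy₃⟩

section checks
example : rotUnit Sym.e * rotUnit Sym.ebar = 1 := by decide
example : (rotUnit Sym.e) ^ 4 = 1 := by decide
example : conjL (Letter.rotI ⟨0, 5, 1⟩) = ⟨0, -1, -5⟩ ∧ Letter.rotI (conjL ⟨0, 5, 1⟩) = ⟨0, 1, 5⟩ := by decide
end checks

/-! ## §8 Linkage to the decl of record `HeightTower.FloorFree` (v1.2; `HeightTower` built under req-114)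
`HeightTower.FloorFree h B rmin` and `FloorFreeV h B rmin` have literally the same body up to bundling the six hypotheses into `Valid`, so the
link is `floorFreeV_iff_spelled` read backwards; the primed corollaries are the normal forms of §6–§7 stated for the decl of record. -/

/-- The decl of record IS the bundled floor statement. -/
theorem floorFree_iff_floorFreeV (h : ℤ) (B : ℕ) (rmin : ℤ) : HeightTower.FloorFree h B rmin ↔ FloorFreeV h B rmin :=
  (floorFreeV_iff_spelled h B rmin).symm

/-- `HeightTower.FloorFree` on P-cells only (F1). -/
theorem floorFree_iff_P' (h : ℤ) (B : ℕ) (rmin : ℤ) :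
    HeightTower.FloorFree h B rmin ↔ ∀ D : Design, Valid h B rmin D → ∀ c ∈ D.suppP, ∀ f : Fin 4, 0 < (c f).a := by
  rw [floorFree_iff_floorFreeV, floorFree_iff_P]

/-- `HeightTower.FloorFree` with the floor letter WLOG on factor `0` (F2). -/
theorem floorFree_iff_factor0' (h : ℤ) (B : ℕ) (rmin : ℤ) :
    HeightTower.FloorFree h B rmin ↔ ∀ D : Design, Valid h B rmin D → ∀ c ∈ D.suppP, 0 < (c 0).a := by
  rw [floorFree_iff_floorFreeV, floorFree_iff_factor0]

/-- `HeightTower.FloorFree` in octant normal form: no valid design has a P-cell with `c 0 = (0; x, y)`, `0 < y ≤ x`. -/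
theorem floorFree_iff_octant' (h : ℤ) (B : ℕ) (rmin : ℤ) :
    HeightTower.FloorFree h B rmin ↔ ∀ D : Design, Valid h B rmin D → ∀ c ∈ D.suppP,
      ¬ ((c 0).a = 0 ∧ 0 < (c 0).y ∧ (c 0).y ≤ (c 0).x) := by
  rw [floorFree_iff_floorFreeV, floorFree_iff_octant]

/-- `HeightTower.FloorFree` in whole-cell normal form: no valid design has a `CellNormal` P-cell
(factor `0` an octant floor letter, factors `1, 2, 3` in the open first quadrant). -/
theorem floorFree_iff_cellNormal' (h : ℤ) (B : ℕ) (rmin : ℤ) :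
    HeightTower.FloorFree h B rmin ↔ ∀ D : Design, Valid h B rmin D → ∀ c ∈ D.suppP, ¬ CellNormal c := by
  rw [floorFree_iff_floorFreeV, floorFree_iff_cellNormal]

/-- Instance of record: the nine storeys of `HeightTower.nonex_14_iff_floors` in `CellNormal` form. -/
theorem floorFree_199_8_iff_cellNormal (h : ℤ) :
    HeightTower.FloorFree h 199 8 ↔ ∀ D : Design, Valid h 199 8 D → ∀ c ∈ D.suppP, ¬ CellNormal c :=
  floorFree_iff_cellNormal' h 199 8

end Summit.HodgeConjecture.HodgeConjecture.Cruxes.BlochSeedDiscOne.B4FloorSymmetry
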